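import Literature.Analysis.FluidPDE.TsaiProfileEndgame
import Literature.Analysis.FluidPDE.TsaiPressureGrowth
import HarnessLib

/-!
# Tsai's Theorems 1 and 2 with Lemma 3.2 replaced by its proof from the interior Stokes estimate

Analysis/FluidPDE proofs layer (theorems only). `TsaiPressureGrowth` proves Tsai's Lemma 3.2
(`tsai1998_lemma32`, polynomial growth of the pressure of a Leray profile in `L^q`) from the
regularity of profiles (`tsai1998_profile_smooth`), the interior `L^r` estimate for the Stokes
system (`stokes_interior_Lr_estimate`, Tsai's (3.2) ← Galdi) and — only for `3 ≤ q < 4` — Stein's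
`L^p` bound for the normalised pressure (`stein1970_normalisedPressure_Lp_bound`). Feeding this into
the endgame of `TsaiProfileEndgame` gives:

* `tsai_selfsimilar_of_stokes_facts : tsai1998_profile_smooth → tsai1998_lemma33 →
    stokes_interior_Lr_estimate → stein1970_normalisedPressure_Lp_bound → tsai_selfsimilar`
  (Tsai 1998, **Theorem 1**; the named fact `tsai1998_lemma32` no longer appears);
* `tsai_selfsimilar_local_energy_of_stokes : tsai1998_profile_smooth →
    stokes_interior_Lr_estimate → tsai1998_lemma41 → tsai1998_lemma42 → tsai_selfsimilar_local_energy`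
  (Tsai 1998, **Theorem 2**): the proof of `tsai_selfsimilar_local_energy_of_lemma32` uses Lemma 3.2
  only with `U ∈ L⁴` (Corollary 4.3 gives `U = O(|y|⁻¹)`), where the Stein fact is not needed
  (`tsai1998_lemma32_restricted_of_stokes`), so Theorem 2 now rests on the regularity of profiles,
  the interior Stokes estimate, Lemma 4.1 and Lemma 4.2.

## References

* T.-P. Tsai, *On Leray's self-similar solutions of the Navier–Stokes equations satisfying local
  energy estimates*, Arch. Rational Mech. Anal. 143 (1998): Theorems 1–2 (p. 31), Lemma 3.2 (p. 39),
  §4 (Lemma 4.1, Lemma 4.2, Corollary 4.3), §5 (pp. 47–49) [Tsai1998].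
-/

noncomputable section

open MeasureTheory Set Function Filter Topology InnerProductSpace Metric
open scoped RealInnerProductSpace Laplacian ContDiff ENNReal NNReal

namespace Literature.Analysis.FluidPDE

/-- **Tsai 1998, Theorem 1, from Lemma 3.3, the regularity of profiles, the interior Stokes estimate
and Stein's `L^p` bound** (Lemma 3.2 being proved from the last three, `tsai1998_lemma32_of_facts`).
[cite: Tsai1998, Theorem 1 (p. 31)] -/
theorem tsai_selfsimilar_of_stokes_facts (hreg : tsai1998_profile_smooth) (h33 : tsai1998_lemma33)
    (hSt : stokes_interior_Lr_estimate) (hStein : stein1970_normalisedPressure_Lp_bound) :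
    tsai_selfsimilar :=
  tsai_selfsimilar_of_growth_lemmas hreg h33 (tsai1998_lemma32_of_facts hreg hSt hStein)

/-- **Tsai 1998, Theorem 2, from the regularity of profiles, the interior Stokes estimate,
Lemma 4.1 and Lemma 4.2** (the proof of `tsai_selfsimilar_local_energy_of_lemma32` with Lemma 3.2
at `q = 4` supplied by `tsai1998_lemma32_restricted_of_stokes`; no Calderón–Zygmund input beyond
the tree's proved `L²` theory of the normalised pressure). [cite: Tsai1998, Theorem 2 (p. 31) and its proof (p. 47)] -/
theorem tsai_selfsimilar_local_energy_of_stokes (hreg : tsai1998_profile_smooth)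
    (hSt : stokes_interior_Lr_estimate) (h41 : tsai1998_lemma41) (h42 : tsai1998_lemma42) :
    tsai_selfsimilar_local_energy := by
  intro ν a T t₀ hν ha ht₀ U P hprof henergy hgrad
  obtain ⟨C, R, hdecay⟩ := tsai1998_corollary43 h41 (tsai1998_top_singular_null_of_lemma42 h42)
    hν ha ht₀ hprof henergy hgrad
  have hU4 : MemLp U 4 volume :=
    memLp_of_norm_mul_norm_le hprof.contDiff_velocity.continuous hdecay (by norm_num)
      ENNReal.ofNat_lt_top
  have hU3 : ContDiff ℝ 3 U := contDiff_infty.1 (hreg hν ha hprof) 3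
  have hP2 : ContDiff ℝ 2 P := hprof.contDiff_two_pressure hU3
  obtain ⟨N, C', R', hPR⟩ := tsai1998_lemma32_restricted_of_stokes hreg hSt hν ha hprof le_rfl hU4
  -- `|y| |U(y)| ≤ C` for `|y| ≥ R` gives `|U(y)| ≤ (a/2)|y|` for `|y| ≥ max (max R 1) (2|C|/a)`
  have hUb : ∀ y : EuclideanSpace ℝ (Fin 3),
      max (max R 1) (2 * |C| / a) ≤ ‖y‖ → ‖U y‖ ≤ a / 2 * ‖y‖ := by
    intro y hy
    have hR : R ≤ ‖y‖ := le_trans (le_trans (le_max_left _ _) (le_max_left _ _)) hy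
    have h1 : 1 ≤ ‖y‖ := le_trans (le_trans (le_max_right _ _) (le_max_left _ _)) hy
    have h2 : 2 * |C| / a ≤ ‖y‖ := le_trans (le_max_right _ _) hy
    have h2' : 2 * |C| ≤ a * ‖y‖ := by rwa [div_le_iff₀' ha] at h2
    have hd : ‖y‖ * ‖U y‖ ≤ |C| := (hdecay y hR).trans (le_abs_self C)
    have h3 : ‖y‖ * ‖U y‖ ≤ ‖y‖ * (a / 2) := by nlinarith
    have h4 : ‖U y‖ ≤ a / 2 := le_of_mul_le_mul_left h3 (by linarith)
    nlinarith
  exact hprof.eq_zero_of_growth hν ha hU3 hP2 (half_pos ha).le (half_lt_self ha) hUb hPR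
    (by norm_num) ENNReal.ofNat_ne_top hU4

end Literature.Analysis.FluidPDE

end
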